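import Mathlib
import HarnessLib

/-!
# `RationalShortRootRigidity` — Step 2 helper (m7), part I: line divisions and the `u₃`-factorisation

Helper lemmas INSIDE the paper proof of crux `stmt-QuantumFields-23124` (`F4SubCurvatureDoor.RationalShortRootRigidity`,
LINE g15-A of planner ym-idea-3; prover notes HOME l15/PLANAR-LEMMA-DETAILED.md, Step (2a) «D₃-invariance ⇒ b ∈ ℝ[u₂,u₃]»;
free-hands menu II, item (m7) `Helpers.DihedralChevalley`).  This part I is the division engine for the inductive proof of
(m7) in part II (`RationalShortRootRigidityDihedralChevalley.lean`):

* `X_one_sub_C_mul_X_zero_dvd` — a real polynomial `P(x,y)` vanishing on the line `y = a·x` is divisible by `y − a·x`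
  (read `P ∈ ℝ[x][y]` after swapping the variables, `MvPolynomial.finSuccEquiv`; `y − a x` is monic linear in `y`, so
  `Polynomial.dvd_iff_isRoot`; the root value vanishes pointwise, hence is `0` by `MvPolynomial.funext` — the method of
  `nullConeDivisibility`, p662563);
* `eval_line_eq_zero_of_mul` — if `L·P₁` vanishes on the line and `L ≠ 0` on the punctured line, `P₁` vanishes on the line
  (its restriction is a real polynomial with infinitely many roots);
* `exists_eq_u3_mul` — a polynomial vanishing on the three lines `y = 0`, `y = ±√3·x` is `u₃ · Q`, `u₃ = 3x²y − y³ =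
  −y(y − √3 x)(y + √3 x)`;
* degree bookkeeping: `exists_axis_polynomial` (the restriction `b(x,0)` is a real polynomial of degree `≤ totalDegree b`),
  `totalDegree_aeval_le`.

Variables: `0 = x`, `1 = y`; points of the plane are written `fun i => if i = 0 then x else y` as in the menu statement.
Mathlib only; THEOREMS ONLY (no definitions); no named facts; no `sorry`; default heartbeats.  Nothing about the crux 23124,
the route's rung or the Yang–Mills mass gap is proved here.  Free-hands seat `ym-line-frs-p2` g10, `--supports
stmt-QuantumFields-23124`.
-/

set_option autoImplicit false

namespace Summit.QuantumFields.YangMills.Theorems.RationalShortRootRigidity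

open scoped BigOperators Polynomial

/-! ## 1. Division by the line `y = a·x` -/

/-- Under «swap the variables, then `finSuccEquiv`» the linear form `y − a·x` becomes the monic linear polynomial
`X − C(a·x)` over `ℝ[x]`. [folklore] -/
theorem finSuccEquiv_swap_line (a : ℝ) :
    MvPolynomial.finSuccEquiv ℝ 1
        (MvPolynomial.rename (Equiv.swap (0 : Fin 2) 1)
          (MvPolynomial.X 1 - MvPolynomial.C a * MvPolynomial.X 0 : MvPolynomial (Fin 2) ℝ)) =
      Polynomial.X - Polynomial.C (MvPolynomial.C a * MvPolynomial.X 0) := by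
  rw [map_sub, map_mul, MvPolynomial.rename_X, MvPolynomial.rename_X, MvPolynomial.rename_C,
    Equiv.swap_apply_right, Equiv.swap_apply_left, map_sub, map_mul, MvPolynomial.finSuccEquiv_X_zero]
  have h1 : MvPolynomial.finSuccEquiv ℝ 1 (MvPolynomial.X 1) = Polynomial.C (MvPolynomial.X 0) :=
    MvPolynomial.finSuccEquiv_X_succ (j := 0)
  have h2 : MvPolynomial.finSuccEquiv ℝ 1 (MvPolynomial.C a) = Polynomial.C (MvPolynomial.C a) := by
    rw [MvPolynomial.finSuccEquiv_apply, MvPolynomial.eval₂Hom_C, RingHom.comp_apply]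
  rw [h1, h2, ← map_mul]

/-- A real polynomial in the plane vanishing on the line `y = a·x` is divisible by `y − a·x`. [folklore] -/
theorem X_one_sub_C_mul_X_zero_dvd (P : MvPolynomial (Fin 2) ℝ) (a : ℝ)
    (h : ∀ x : ℝ, MvPolynomial.eval (fun i : Fin 2 => if i = 0 then x else a * x) P = 0) :
    (MvPolynomial.X 1 - MvPolynomial.C a * MvPolynomial.X 0) ∣ P := by
  -- swap the variables so that `y` is variable `0`, and read `P` in `ℝ[x][y]`
  set e := MvPolynomial.renameEquiv ℝ (Equiv.swap (0 : Fin 2) 1) with he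
  set F : Polynomial (MvPolynomial (Fin 1) ℝ) := MvPolynomial.finSuccEquiv ℝ 1 (e P) with hF
  set r : MvPolynomial (Fin 1) ℝ := MvPolynomial.C a * MvPolynomial.X 0 with hr
  -- the root value `F(a·x) ∈ ℝ[x]` vanishes pointwise, hence is zero
  have hroot : F.eval r = 0 := by
    apply MvPolynomial.funext
    intro s
    have hr' : MvPolynomial.eval s r = a * s 0 := by
      simp only [hr, map_mul, MvPolynomial.eval_C, MvPolynomial.eval_X]
    rw [map_zero, ← Polynomial.eval₂_at_apply (MvPolynomial.eval s) r, ← Polynomial.eval_map, hr', hF,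
      ← MvPolynomial.eval_eq_eval_mv_eval' s (a * s 0) (e P), he, MvPolynomial.renameEquiv_apply,
      MvPolynomial.eval_rename]
    have hpt : (Fin.cons (a * s 0) s : Fin 2 → ℝ) ∘ (Equiv.swap (0 : Fin 2) 1) =
        fun i : Fin 2 => if i = 0 then s 0 else a * s 0 := by
      funext i
      fin_cases i
      · simp [Equiv.swap_apply_left]
      · simp [Equiv.swap_apply_right]
    rw [hpt]
    exact h (s 0)
  have hdvd : Polynomial.X - Polynomial.C r ∣ F := Polynomial.dvd_iff_isRoot.2 hroot
  rw [← map_dvd_iff e, ← map_dvd_iff (MvPolynomial.finSuccEquiv ℝ 1), he, MvPolynomial.renameEquiv_apply,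
    finSuccEquiv_swap_line]
  exact hdvd

/-- If `L · P₁` vanishes on the line `y = a·x` and `L` does not vanish on the punctured line, then `P₁` vanishes on the
whole line (its restriction to the line is a real polynomial with infinitely many roots). [folklore] -/
theorem eval_line_eq_zero_of_mul (L P₁ : MvPolynomial (Fin 2) ℝ) (a : ℝ)
    (hL : ∀ x : ℝ, x ≠ 0 → MvPolynomial.eval (fun i : Fin 2 => if i = 0 then x else a * x) L ≠ 0)
    (h : ∀ x : ℝ, MvPolynomial.eval (fun i : Fin 2 => if i = 0 then x else a * x) (L * P₁) = 0) :
    ∀ x : ℝ, MvPolynomial.eval (fun i : Fin 2 => if i = 0 then x else a * x) P₁ = 0 := by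
  -- the restriction of `P₁` to the line, as a real polynomial in `x`
  set g : ℝ[X] := MvPolynomial.aeval
    (fun i : Fin 2 => if i = 0 then (Polynomial.X : ℝ[X]) else Polynomial.C a * Polynomial.X) P₁ with hg
  have hg_eval : ∀ x : ℝ, g.eval x = MvPolynomial.eval (fun i : Fin 2 => if i = 0 then x else a * x) P₁ := by
    intro x
    have hpt : (fun i : Fin 2 => (Polynomial.aeval x)
        (if i = 0 then (Polynomial.X : ℝ[X]) else Polynomial.C a * Polynomial.X)) =
        fun i : Fin 2 => if i = 0 then x else a * x := by
      funext i
      split_ifs <;> simp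
    rw [hg, ← Polynomial.coe_aeval_eq_eval, MvPolynomial.comp_aeval_apply, MvPolynomial.aeval_eq_eval, hpt]
  have hroots : ∀ x : ℝ, x ≠ 0 → g.IsRoot x := by
    intro x hx
    have hx' := h x
    rw [map_mul] at hx'
    rw [Polynomial.IsRoot, hg_eval]
    exact (mul_eq_zero.1 hx').resolve_left (hL x hx)
  have hinf : Set.Infinite {x : ℝ | g.IsRoot x} :=
    ((Set.finite_singleton (0 : ℝ)).infinite_compl).mono fun x hx =>
      hroots x (by simpa only [Set.mem_compl_iff, Set.mem_singleton_iff] using hx)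
  have hg0 : g = 0 := Polynomial.eq_zero_of_infinite_isRoot g hinf
  intro x
  rw [← hg_eval, hg0, Polynomial.eval_zero]

/-! ## 2. The `u₃`-factorisation -/

/-- A real polynomial in the plane vanishing on the three lines `y = 0`, `y = √3·x`, `y = −√3·x` is a multiple of
`u₃ = 3x²y − y³` (`= −y(y − √3x)(y + √3x)`). [folklore] -/
theorem exists_eq_u3_mul (P : MvPolynomial (Fin 2) ℝ)
    (h0 : ∀ x : ℝ, MvPolynomial.eval (fun i : Fin 2 => if i = 0 then x else 0 * x) P = 0)
    (h1 : ∀ x : ℝ, MvPolynomial.eval (fun i : Fin 2 => if i = 0 then x else Real.sqrt 3 * x) P = 0)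
    (h2 : ∀ x : ℝ, MvPolynomial.eval (fun i : Fin 2 => if i = 0 then x else -Real.sqrt 3 * x) P = 0) :
    ∃ Q : MvPolynomial (Fin 2) ℝ,
      P = (3 * MvPolynomial.X 0 ^ 2 * MvPolynomial.X 1 - MvPolynomial.X 1 ^ 3) * Q := by
  have hs : Real.sqrt 3 * Real.sqrt 3 = 3 := Real.mul_self_sqrt (by norm_num)
  have hs0 : Real.sqrt 3 ≠ 0 := Real.sqrt_ne_zero'.2 (by norm_num)
  -- divide by `y`
  obtain ⟨P₁, hP₁⟩ := X_one_sub_C_mul_X_zero_dvd P 0 h0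
  rw [map_zero, zero_mul, sub_zero] at hP₁
  -- divide by `y − √3 x`
  have h1' : ∀ x : ℝ, MvPolynomial.eval (fun i : Fin 2 => if i = 0 then x else Real.sqrt 3 * x) P₁ = 0 := by
    refine eval_line_eq_zero_of_mul (MvPolynomial.X 1) P₁ (Real.sqrt 3) (fun x hx => ?_) (fun x => ?_)
    · simp only [MvPolynomial.eval_X, Fin.one_eq_zero_iff, OfNat.ofNat_ne_one, if_false]
      exact mul_ne_zero hs0 hx
    · rw [← hP₁]; exact h1 x
  obtain ⟨P₂, hP₂⟩ := X_one_sub_C_mul_X_zero_dvd P₁ (Real.sqrt 3) h1'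
  -- divide by `y + √3 x`
  have h2' : ∀ x : ℝ, MvPolynomial.eval (fun i : Fin 2 => if i = 0 then x else -Real.sqrt 3 * x) P₂ = 0 := by
    refine eval_line_eq_zero_of_mul (MvPolynomial.X 1 * (MvPolynomial.X 1 - MvPolynomial.C (Real.sqrt 3) *
      MvPolynomial.X 0)) P₂ (-Real.sqrt 3) (fun x hx => ?_) (fun x => ?_)
    · simp only [map_mul, map_sub, MvPolynomial.eval_X, MvPolynomial.eval_C, Fin.one_eq_zero_iff,
        OfNat.ofNat_ne_one, if_false, if_true]
      have : -Real.sqrt 3 * x * (-Real.sqrt 3 * x - Real.sqrt 3 * x) = 6 * (x * x) := by nlinarith [hs]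
      rw [this]
      exact mul_ne_zero (by norm_num) (mul_ne_zero hx hx)
    · rw [mul_assoc, ← hP₂, ← hP₁]; exact h2 x
  obtain ⟨P₃, hP₃⟩ := X_one_sub_C_mul_X_zero_dvd P₂ (-Real.sqrt 3) h2'
  refine ⟨-P₃, ?_⟩
  have hc : MvPolynomial.C (Real.sqrt 3) * MvPolynomial.C (Real.sqrt 3) = (3 : MvPolynomial (Fin 2) ℝ) := by
    rw [← map_mul, hs]; exact map_ofNat _ 3
  rw [hP₁, hP₂, hP₃, map_neg]
  linear_combination (-(MvPolynomial.X 1 * P₃ * MvPolynomial.X 0 ^ 2)) * hc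

/-- `u₃ = 3x²y − y³` is not the zero polynomial (it is `1` at `(0,−1)`). [folklore] -/
theorem u3_ne_zero : (3 * MvPolynomial.X 0 ^ 2 * MvPolynomial.X 1 - MvPolynomial.X 1 ^ 3 :
    MvPolynomial (Fin 2) ℝ) ≠ 0 := by
  intro h
  have := congrArg (MvPolynomial.eval (fun i : Fin 2 => if i = 0 then (0 : ℝ) else -1)) h
  simp at this

/-- `u₃` has positive total degree (it is not constant: `0` at the origin, `1` at `(0,−1)`). [folklore] -/
theorem totalDegree_u3_pos : 0 < (3 * MvPolynomial.X 0 ^ 2 * MvPolynomial.X 1 - MvPolynomial.X 1 ^ 3 :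
    MvPolynomial (Fin 2) ℝ).totalDegree := by
  rw [pos_iff_ne_zero]
  intro h
  rw [MvPolynomial.totalDegree_eq_zero_iff_eq_C] at h
  have h0 := congrArg (MvPolynomial.eval (fun _ : Fin 2 => (0 : ℝ))) h
  have h1 := congrArg (MvPolynomial.eval (fun i : Fin 2 => if i = 0 then (0 : ℝ) else -1)) h
  simp at h0 h1
  linarith

/-! ## 3. Degree bookkeeping -/

/-- The restriction `x ↦ b(x,0)` is a real polynomial of degree `≤ totalDegree b`. [folklore] -/
theorem exists_axis_polynomial (b : MvPolynomial (Fin 2) ℝ) :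
    ∃ h : ℝ[X], (∀ x : ℝ, MvPolynomial.eval (fun i : Fin 2 => if i = 0 then x else 0) b = h.eval x) ∧
      h.natDegree ≤ b.totalDegree := by
  refine ⟨Polynomial.map (MvPolynomial.eval (fun _ : Fin 1 => (0 : ℝ))) (MvPolynomial.finSuccEquiv ℝ 1 b),
    fun x => ?_, ?_⟩
  · have hpt : (fun i : Fin 2 => if i = 0 then x else (0 : ℝ)) = Fin.cons x (fun _ : Fin 1 => (0 : ℝ)) := by
      funext i
      fin_cases i <;> rfl
    rw [← MvPolynomial.eval_eq_eval_mv_eval', hpt]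
  · exact Polynomial.natDegree_map_le.trans
      ((MvPolynomial.natDegree_finSuccEquiv b).le.trans (MvPolynomial.degreeOf_le_totalDegree b 0))

/-- Total degree of a univariate polynomial evaluated at a multivariate one. [folklore] -/
theorem totalDegree_aeval_le (u : MvPolynomial (Fin 2) ℝ) (p : ℝ[X]) :
    (Polynomial.aeval u p).totalDegree ≤ p.natDegree * u.totalDegree := by
  rw [Polynomial.aeval_eq_sum_range]
  refine (MvPolynomial.totalDegree_finsetSum _ _).trans (Finset.sup_le fun i hi => ?_)
  have hi' : i ≤ p.natDegree := Nat.lt_succ_iff.1 (Finset.mem_range.1 hi)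
  calc (p.coeff i • u ^ i).totalDegree ≤ (u ^ i).totalDegree := MvPolynomial.totalDegree_smul_le _ _
    _ ≤ i * u.totalDegree := MvPolynomial.totalDegree_pow _ _
    _ ≤ p.natDegree * u.totalDegree := Nat.mul_le_mul_right _ hi'

/-- `totalDegree (x² + y²) ≤ 2`. [folklore] -/
theorem totalDegree_u2_le : (MvPolynomial.X 0 ^ 2 + MvPolynomial.X 1 ^ 2 : MvPolynomial (Fin 2) ℝ).totalDegree ≤ 2 := by
  refine (MvPolynomial.totalDegree_add _ _).trans (max_le ?_ ?_) <;>
    exact (MvPolynomial.totalDegree_X_pow _ _).le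

end Summit.QuantumFields.YangMills.Theorems.RationalShortRootRigidity
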